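import Literature.AnabelianGeometry.EtaleTheta.Discharge.Sec2Cor218LevelsOfModel
import Literature.AnabelianGeometry.EtaleTheta.Discharge.Sec2Cor218QuotientFibreIff
import Literature.AnabelianGeometry.EtaleTheta.Discharge.Sec2OddBijectivityOfFacts
import Literature.AnabelianGeometry.EtaleTheta.Discharge.Sec2ModelCor219
import Literature.AnabelianGeometry.EtaleTheta.Discharge.Sec2LevelOneLifting
import Literature.AnabelianGeometry.EtaleTheta.Discharge.Sec2RigidityAtModelChi
import Literature.AnabelianGeometry.EtaleTheta.Discharge.Sec1CompatOfSetting
import Literature.AnabelianGeometry.EtaleTheta.SettingModelChiGroupLevelHolds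
import HarnessLib

/-!
# [EtTh] Cor. 2.18 (iii), (iv) and Cor. 2.19 (i), (ii) for the §1 → §2 model AT THE RECORD MODEL
# `ThetaSetting.modelχ p`: temp-slimness of `Π^tp_X` and openness of `Π^tp_X ↠ G_K` are THEOREMS there
# (proof-only capstone; FROZEN FACT-LIST rows F-0636, F-0637, F-0622, F-0623, F-0648, F-0647, F-0649)

Mochizuki, *The Étale Theta Function and its Frobenioid-theoretic Manifestations* [EtTh], Publ. RIMS
**45** (2009), §2: Cor. 2.18 (iii) p. 61, Cor. 2.18 (iv) pp. 61–62, Cor. 2.19 (i), (ii) p. 64, Prop. 2.4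
p. 38 (locators `p.N` = PDF pages of the PRIMS text; bib key `MochizukiEtTh2009`); [SemiAnbd] Ex. 3.10
p. 45 («both `Δ` and `Π` are temp-slim»).  Cell `abc-iut`, block F, seat abc-iut-f-150 (gen 2; F-TRANCHES
tranche 150 = F-0635/F-0636/F-0637).  PROOF-ONLY: no definition, no instance, no new named fact; nothing of
another seat is edited or restated — every input is consumed BY NAME.

STATE OF RECORD.  Over the lawless interfaces `ThetaEnvData N` / `RigidData N l` the universal closures of
Cor. 2.18 (iii) (`ThetaEnvData.Cor218_iii_PiX` F-0636, `.Cor218_iii_quotient` F-0637, `RigidData.…` F-0622 /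
F-0623) are REFUTED at explicit toys (abc-iut-w5-d175, abc-iut-w5-d071), so the rows are consumable AT A
NAMED INSTANCE only (R5).  The named instance the cone consumes is abc-iut-L2-t8's §1 → §2 adapter
(`C.thetaEnvData μ hC hS`, `C.thetaEnvTower τ hC hS`, `C.rigidData μ hC hS h15 L`) over a theta setting
`D`; there lane C2 PROVED the rows modulo temp-slimness of `Π^tp_X` (`hslimX : IsSlimGroup D.PiTemp`,
[SemiAnbd] Ex. 3.10; gen 0 of this seat: `thetaEnvData_cor218_iii_PiX/_quotient`, abc-iut-f-147:
`rigidData_cor218_iii_of_isSlimGroup`), and the Cor. 2.18 (iv) / Cor. 2.19 model theorems of abc-iut-L2-d1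
(`cor218_iv_reduction_model`, `cor219_ii_model`, `exists_iso_of_systems_model`, `cor219_i_*_model`,
`exists_iso_lift_of_levelOne_model`) modulo `hslimX` AND openness of the augmentation
(`haugOpen : IsOpenMap D.aug`), plus — in their `_of_origin` / `_of_facts` forms — the §1 origin clauses
`IsEtThOrigin`, `hYcl`.

THIS FILE.  At the record model `ThetaSetting.modelχ p` of the R78 cluster (abc-iut-L2-t1;
`toTemperedCurve := curveχ p`, `Π^tp_X = Γ ⋊_χ G_{ℚ_p}`, `Γ = F̂₂ ×_Ẑ ℤ`) ALL FOUR binders are THEOREMS: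
`hslimX` is abc-iut-w5-d111's `isSlimGroup_piTemp_curveχ` (over abc-iut-w5-d249's `isSlimGroup_PiTpχ` and
`isSlimGroup_gfp`), `haugOpen` is abc-iut-L2-t1's `isOpenMap_aug_modelχ`, `IsEtThOrigin` / `hYcl` are
`modelχ_isEtThOrigin` / `hYcl_modelχ`; moreover `Sec2Hyps` is abc-iut-L2-d1's `modelχ_sec2Hyps` and `Compat`
follows (`Sec2Hyps.compat`).  Hence, for EVERY étale-theta datum `E` over `modelχ p`, every `X̲̲`-choice
`C : E.DoubleUnderline l`, every level `μ` / tower `τ`: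

* §1 — **F-0636 / F-0637 (and the `RigidData` twins F-0622 / F-0623) HOLD at the record model with NO
  slimness binder**: `thetaEnvData_cor218_iii_PiX_modelχ`, `thetaEnvData_cor218_iii_quotient_modelχ`, the
  tower-level and `RigidData` twins, and the DATA-ONLY census form `thetaEnvData_cor218_iii_modelχ_holds`
  (binders = `E`, `C`, `μ`; `hC`, `hS` supplied too);
* §2 — **Cor. 2.18 (iv), reduction clause (F-0648) HOLDS at the record model tower with NO binder beyond the
  construction data** (`cor218_iv_reduction_modelχ`); the odd-bijectivity clause (F-0647) modulo the
  level-wise first half of Cor. 2.18 (iv) only (`cor218_iv_bijective_of_odd_modelχ`), resp. modulo the L2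
  FACT-policy floor MINUS {`IsSlimGroup`, `IsOpenMap aug`, `IsEtThOrigin`, `hYcl`} (`…_modelχ_of_facts`);
* §3 — **Cor. 2.19 (ii) (F-0649) and its strong form at the record model tower** modulo the level-wise
  Cor. 2.18 (iv) surjectivity ALONE (`cor219_ii_modelχ_of_lift`: Prop. 2.14 (i) being abc-iut-f-149's
  `rigidData_prop214_i_modelχ`), resp. modulo {Prop. 1.5 (ii), (iii), Cor. 2.18 (i) at the chain levels,
  `ThetaEnvTower.Cor219_iii`} (`cor219_ii_modelχ_of_facts`, `exists_iso_of_systems_modelχ_of_facts`);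
  Cor. 2.19 (i) subquotients / splittings modulo Cor. 2.18 (i) alone; level-`1` lifting / finite fibres.

HONEST LABEL: `modelχ` is a SEMI-SYNTHETIC model of the typed §1 interface (not the tempered `π₁` of a
curve) — this file is consistency / joint-satisfiability evidence for the binder set
{`IsSlimGroup Π^tp_X`, `IsOpenMap aug`, `IsEtThOrigin`, `hYcl`, `Sec2Hyps`, `Compat`} of the lane-C2
discharges (none of their antecedents is vacuous at the inhabitant of record), and the kernel record that the
FACT rows above are THEOREMS at that inhabitant; nothing of [EtTh] / [SemiAnbd] (refereed) is asserted; no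
side is taken on [IUTchIII] Cor. 3.12; typed ≠ proved; a FACT row is an assumption label, not an endorsement.
-/

noncomputable section

namespace Literature.AnabelianGeometry.EtaleTheta.SettingModel

open Literature.AnabelianGeometry.SemiGraphs
open Literature.AlgebraicGeometry.Frobenioids (IsSlimGroup)

variable (p : ℕ) [Fact p.Prime]
variable {E : (ThetaSetting.modelχ p).EtaleThetaData} {l : ℕ} (C : E.DoubleUnderline l) {N : ℕ+}
  (μ : (ThetaSetting.modelχ p).CyclotomeMod l N) {Es : Set ℕ+}
  (τ : (ThetaSetting.modelχ p).CyclotomeTower l Es)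

/-! ## §0. The two interface binders at the record model -/

/-- **`Π^tp_X` of the record model `modelχ p` is temp-slim** — the binder `hslimX : IsSlimGroup D.PiTemp`
of lane C2, read at `D := modelχ p` (`modelχ.toTemperedCurve := curveχ p`; abc-iut-w5-d111's
`isSlimGroup_piTemp_curveχ`: `Γ ⋊_χ G_{ℚ_p}` is slim since `Γ = F̂₂ ×_Ẑ ℤ` and `G_{ℚ_p}` are).
[cite: MochizukiSemiAnbd2006, Ex 3.10 p.45] -/
theorem isSlimGroup_piTemp_modelχ : IsSlimGroup (ThetaSetting.modelχ p).PiTemp :=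
  isSlimGroup_piTemp_curveχ p

/-- **`Compat` holds at the record model** (from abc-iut-L2-d1's `modelχ_sec2Hyps` by `Sec2Hyps.compat`).
[cite: MochizukiEtTh2009, Prop 1.5 p.22] -/
theorem compat_modelχ : (ThetaSetting.modelχ p).Compat :=
  (ThetaSetting.modelχ_sec2Hyps p).compat

/-! ## §1. Cor. 2.18 (iii) at the record model — F-0636 / F-0637 / F-0622 / F-0623 with NO slimness binder -/

/-- **F-0636 `ThetaEnvData.Cor218_iii_PiX` HOLDS at the record model** ([EtTh] Cor. 2.18 (iii), p. 61:
`Π•_X ≅ Π^tp_X`, i.e. conjugation `Π^tp_X̲̲ → Aut(Π^tp_Y̲̲)` is injective): for every étale-theta datum over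
`modelχ p`, every `X̲̲` and level — gen 0's `thetaEnvData_cor218_iii_PiX` with `hslimX` SUPPLIED.
[cite: MochizukiEtTh2009, Cor 2.18(iii) p.61] -/
theorem thetaEnvData_cor218_iii_PiX_modelχ (hC : (ThetaSetting.modelχ p).Compat)
    (hS : (ThetaSetting.modelχ p).Sec2Hyps) :
    Literature.AnabelianGeometry.EtaleTheta.ThetaEnvData.Cor218_iii_PiX (C.thetaEnvData μ hC hS) :=
  C.thetaEnvData_cor218_iii_PiX μ hC hS (isSlimGroup_piTemp_modelχ p)

/-- **F-0637 `ThetaEnvData.Cor218_iii_quotient` HOLDS at the record model** ([EtTh] Cor. 2.18 (iii), p. 61: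
the kernel of `Π• ↠ Π•_Y` is the union of the centralisers of the open subgroups, Prop. 2.11 (ii)) — gen 0's
`thetaEnvData_cor218_iii_quotient` with `hslimX` SUPPLIED. [cite: MochizukiEtTh2009, Cor 2.18(iii) p.61] -/
theorem thetaEnvData_cor218_iii_quotient_modelχ (hC : (ThetaSetting.modelχ p).Compat)
    (hS : (ThetaSetting.modelχ p).Sec2Hyps) :
    Literature.AnabelianGeometry.EtaleTheta.ThetaEnvData.Cor218_iii_quotient (C.thetaEnvData μ hC hS) :=
  C.thetaEnvData_cor218_iii_quotient μ hC hS (isSlimGroup_piTemp_modelχ p)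

/-- **Both Cor. 2.18 (iii) clauses at the record model, in `ThetaEnvData` currency.**
[cite: MochizukiEtTh2009, Cor 2.18(iii) p.61] -/
theorem thetaEnvData_cor218_iii_modelχ (hC : (ThetaSetting.modelχ p).Compat)
    (hS : (ThetaSetting.modelχ p).Sec2Hyps) :
    Literature.AnabelianGeometry.EtaleTheta.ThetaEnvData.Cor218_iii_PiX (C.thetaEnvData μ hC hS) ∧
      Literature.AnabelianGeometry.EtaleTheta.ThetaEnvData.Cor218_iii_quotient (C.thetaEnvData μ hC hS) :=
  ⟨thetaEnvData_cor218_iii_PiX_modelχ p C μ hC hS, thetaEnvData_cor218_iii_quotient_modelχ p C μ hC hS⟩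

/-- **DATA-ONLY census form of F-0636 / F-0637 at the record model**: with `Sec2Hyps` and `Compat` ALSO
supplied (`modelχ_sec2Hyps`, `compat_modelχ`), both Cor. 2.18 (iii) clauses hold for the theta-environment
data of EVERY `(E, X̲̲, μ)` over `modelχ p` — the binder set is the construction data alone.
[cite: MochizukiEtTh2009, Cor 2.18(iii) p.61] -/
theorem thetaEnvData_cor218_iii_modelχ_holds :
    Literature.AnabelianGeometry.EtaleTheta.ThetaEnvData.Cor218_iii_PiX
        (C.thetaEnvData μ (compat_modelχ p) (ThetaSetting.modelχ_sec2Hyps p)) ∧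
      Literature.AnabelianGeometry.EtaleTheta.ThetaEnvData.Cor218_iii_quotient
        (C.thetaEnvData μ (compat_modelχ p) (ThetaSetting.modelχ_sec2Hyps p)) :=
  thetaEnvData_cor218_iii_modelχ p C μ _ _

/-- **F-0636 at every level `M ∈ E` of the record model tower** — the binder `hP` of abc-iut-L2-d1's
`cor219_ii_of_levels` / `cor218_iv_bijective_of_odd_of_levels`, binder-free at `modelχ`.
[cite: MochizukiEtTh2009, Cor 2.18(iii) p.61] -/
theorem thetaEnvTower_level_cor218_iii_PiX_modelχ (hC : (ThetaSetting.modelχ p).Compat)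
    (hS : (ThetaSetting.modelχ p).Sec2Hyps) (M : Es) :
    Literature.AnabelianGeometry.EtaleTheta.ThetaEnvData.Cor218_iii_PiX ((C.thetaEnvTower τ hC hS).level M) :=
  C.thetaEnvTower_level_cor218_iii_PiX τ hC hS (isSlimGroup_piTemp_modelχ p) M

/-- **F-0637 at every level `M ∈ E` of the record model tower** — the binder `hq`, binder-free at `modelχ`.
[cite: MochizukiEtTh2009, Cor 2.18(iii) p.61] -/
theorem thetaEnvTower_level_cor218_iii_quotient_modelχ (hC : (ThetaSetting.modelχ p).Compat)
    (hS : (ThetaSetting.modelχ p).Sec2Hyps) (M : Es) :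
    Literature.AnabelianGeometry.EtaleTheta.ThetaEnvData.Cor218_iii_quotient
      ((C.thetaEnvTower τ hC hS).level M) :=
  C.thetaEnvTower_level_cor218_iii_quotient τ hC hS (isSlimGroup_piTemp_modelχ p) M

/-- **F-0622 `RigidData.Cor218_iii_PiX` HOLDS at the record model's rigidity data** (abc-iut-f-147's
`rigidData_cor218_iii_of_isSlimGroup`, first component, with `hslimX` SUPPLIED).
[cite: MochizukiEtTh2009, Cor 2.18(iii) p.61] -/
theorem rigidData_cor218_iii_PiX_modelχ (hC : (ThetaSetting.modelχ p).Compat)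
    (hS : (ThetaSetting.modelχ p).Sec2Hyps) (h15 : ThetaSetting.Prop15iii E hC) (L : C.CuspLabels) :
    Literature.AnabelianGeometry.EtaleTheta.RigidData.Cor218_iii_PiX (C.rigidData μ hC hS h15 L) :=
  (C.rigidData_cor218_iii_of_isSlimGroup μ hC hS h15 L (isSlimGroup_piTemp_modelχ p)).1

/-- **F-0623 `RigidData.Cor218_iii_quotient` HOLDS at the record model's rigidity data** (abc-iut-f-147's
`rigidData_cor218_iii_quotient_of_isSlimGroup` with `hslimX` SUPPLIED).
[cite: MochizukiEtTh2009, Cor 2.18(iii) p.61] -/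
theorem rigidData_cor218_iii_quotient_modelχ (hC : (ThetaSetting.modelχ p).Compat)
    (hS : (ThetaSetting.modelχ p).Sec2Hyps) (h15 : ThetaSetting.Prop15iii E hC) (L : C.CuspLabels) :
    Literature.AnabelianGeometry.EtaleTheta.RigidData.Cor218_iii_quotient (C.rigidData μ hC hS h15 L) :=
  C.rigidData_cor218_iii_quotient_of_isSlimGroup μ hC hS h15 L (isSlimGroup_piTemp_modelχ p)

/-- **Both `RigidData` clauses of Cor. 2.18 (iii) at the record model** (F-0622 ∧ F-0623).
[cite: MochizukiEtTh2009, Cor 2.18(iii) p.61] -/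
theorem rigidData_cor218_iii_modelχ (hC : (ThetaSetting.modelχ p).Compat)
    (hS : (ThetaSetting.modelχ p).Sec2Hyps) (h15 : ThetaSetting.Prop15iii E hC) (L : C.CuspLabels) :
    Literature.AnabelianGeometry.EtaleTheta.RigidData.Cor218_iii_PiX (C.rigidData μ hC hS h15 L) ∧
      Literature.AnabelianGeometry.EtaleTheta.RigidData.Cor218_iii_quotient (C.rigidData μ hC hS h15 L) :=
  C.rigidData_cor218_iii_of_isSlimGroup μ hC hS h15 L (isSlimGroup_piTemp_modelχ p)

/-! ## §2. Cor. 2.18 (iv) at the record model tower: reduction (F-0648) binder-free, odd bijectivity (F-0647) -/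

/-- **F-0648 `ThetaEnvTower.Cor218_iv_reduction` HOLDS at the record model tower with NO binder beyond the
construction data** ([EtTh] Cor. 2.18 (iv), p. 61: every automorphism of `M_{M'}` induces one of `M_M`,
`M ∣ M'`) — abc-iut-L2-d1's `cor218_iv_reduction_model` (Kummer lifting on `G_K` + temp-slimness) with
`hslimX := isSlimGroup_piTemp_modelχ`, `haugOpen := isOpenMap_aug_modelχ`.
[cite: MochizukiEtTh2009, Cor 2.18(iv) p.61] -/
theorem cor218_iv_reduction_modelχ (hC : (ThetaSetting.modelχ p).Compat)
    (hS : (ThetaSetting.modelχ p).Sec2Hyps) :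
    Literature.AnabelianGeometry.EtaleTheta.ThetaEnvTower.Cor218_iv_reduction (C.thetaEnvTower τ hC hS) :=
  C.cor218_iv_reduction_model τ hC hS (isSlimGroup_piTemp_modelχ p) (isOpenMap_aug_modelχ p)

/-- **DATA-ONLY census form of F-0648 at the record model** (`Sec2Hyps`, `Compat` supplied as well).
[cite: MochizukiEtTh2009, Cor 2.18(iv) p.61] -/
theorem cor218_iv_reduction_modelχ_holds :
    Literature.AnabelianGeometry.EtaleTheta.ThetaEnvTower.Cor218_iv_reduction
      (C.thetaEnvTower τ (compat_modelχ p) (ThetaSetting.modelχ_sec2Hyps p)) :=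
  cor218_iv_reduction_modelχ p C τ _ _

/-- **F-0647 `ThetaEnvTower.Cor218_iv_bijective_of_odd` at the record model tower** ([EtTh] Cor. 2.18 (iv),
p. 62: "[hence a bijection if `N/M` is odd]"), modulo ONLY the level-wise first half of Cor. 2.18 (iv)
(`Cor218_iv_surjective`, `Cor218_iv_fibre`): gen 0's `cor218_iv_bijective_of_odd_of_model_of_slim` with
`hslimX`, `haugOpen` SUPPLIED (the Cor. 2.18 (iii) inputs and the reduction clause are theorems here).
[cite: MochizukiEtTh2009, Cor 2.18(iv) p.62] -/
theorem cor218_iv_bijective_of_odd_modelχ (hC : (ThetaSetting.modelχ p).Compat)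
    (hS : (ThetaSetting.modelχ p).Sec2Hyps)
    (hlift : ∀ M : Es, ((C.thetaEnvTower τ hC hS).level M).Cor218_iv_surjective)
    (hfib : ∀ M : Es, ((C.thetaEnvTower τ hC hS).level M).Cor218_iv_fibre) :
    Literature.AnabelianGeometry.EtaleTheta.ThetaEnvTower.Cor218_iv_bijective_of_odd
      (C.thetaEnvTower τ hC hS) :=
  C.cor218_iv_bijective_of_odd_of_model_of_slim τ hC hS (isSlimGroup_piTemp_modelχ p)
    (isOpenMap_aug_modelχ p) hlift hfib

/-- **F-0647 at the record model tower, down to the L2 FACT-policy floor MINUS the four interface / origin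
binders**: abc-iut-f-153's `cor218_iv_bijective_of_odd_of_model_of_facts` with `hslimX`, `haugOpen`,
`IsEtThOrigin`, `hYcl` SUPPLIED — residual inputs: Prop. 1.5 (ii), (iii), cusp labels, Cor. 2.18 (i) at the
chain levels (anabelian input, FACT-policy) and the named fact `ThetaEnvTower.Cor219_iii`.
[cite: MochizukiEtTh2009, Cor 2.18(iv) p.62] -/
theorem cor218_iv_bijective_of_odd_modelχ_of_facts (hC : (ThetaSetting.modelχ p).Compat)
    (hS : (ThetaSetting.modelχ p).Sec2Hyps) (h15 : ThetaSetting.Prop15iii E hC)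
    (h15ii : ThetaSetting.Prop15ii E.toKummerData hC) (L : C.CuspLabels)
    (h218i : ∀ M : Es, (C.rigidData (τ.mod M) hC hS h15 L).Cor218_i)
    (h219iii : (C.thetaEnvTower τ hC hS).Cor219_iii) :
    Literature.AnabelianGeometry.EtaleTheta.ThetaEnvTower.Cor218_iv_bijective_of_odd
      (C.thetaEnvTower τ hC hS) :=
  C.cor218_iv_bijective_of_odd_of_model_of_facts τ hC hS h15 h15ii L (isSlimGroup_piTemp_modelχ p)
    (isOpenMap_aug_modelχ p) h218i h219iii (ThetaSetting.modelχ_isEtThOrigin p) (hYcl_modelχ p)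

/-! ## §3. Cor. 2.19 (ii) (F-0649) and (i) at the record model tower -/

/-- **F-0649 `ThetaEnvTower.Cor219_ii` (discrete rigidity) at the record model tower** ([EtTh] Cor. 2.19
(ii), p. 64: "any projective system of mono-theta environments is isomorphic to the natural one"), modulo
ONLY the level-wise first half of Cor. 2.18 (iv): abc-iut-L2-d1's `cor219_ii_model` with `hslimX`,
`haugOpen` SUPPLIED. [cite: MochizukiEtTh2009, Cor 2.19(ii) p.64] -/
theorem cor219_ii_modelχ (hC : (ThetaSetting.modelχ p).Compat) (hS : (ThetaSetting.modelχ p).Sec2Hyps)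
    (hlift : ∀ M : Es, ((C.thetaEnvTower τ hC hS).level M).Cor218_iv_surjective)
    (hfib : ∀ M : Es, ((C.thetaEnvTower τ hC hS).level M).Cor218_iv_fibre) :
    Literature.AnabelianGeometry.EtaleTheta.ThetaEnvTower.Cor219_ii (C.thetaEnvTower τ hC hS) :=
  C.cor219_ii_model τ hC hS (isSlimGroup_piTemp_modelχ p) (isOpenMap_aug_modelχ p) hlift hfib

/-- **F-0649 at the record model tower modulo the level-wise Cor. 2.18 (iv) SURJECTIVITY ALONE** (on
abc-iut-L2-t8's rigidity data): abc-iut-L2-d1's `cor219_ii_model_of_origin` with `hslimX`, `haugOpen`,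
`IsEtThOrigin`, `hYab` (abc-iut-L2-t8's theorem `dtpYTheta_comm`), `hYcl` ALL SUPPLIED — Prop. 2.14 (i), hence
the fibre clause, being theorems at `modelχ` (abc-iut-f-149's `rigidData_prop214_i_modelχ`).
[cite: MochizukiEtTh2009, Cor 2.19(ii) p.64] -/
theorem cor219_ii_modelχ_of_lift (hC : (ThetaSetting.modelχ p).Compat)
    (hS : (ThetaSetting.modelχ p).Sec2Hyps) (h15 : ThetaSetting.Prop15iii E hC) (L : C.CuspLabels)
    (hlift : ∀ M : Es, (C.rigidData (τ.mod M) hC hS h15 L).Cor218_iv_surjective) :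
    Literature.AnabelianGeometry.EtaleTheta.ThetaEnvTower.Cor219_ii (C.thetaEnvTower τ hC hS) :=
  C.cor219_ii_model_of_origin τ hC hS h15 L (isSlimGroup_piTemp_modelχ p) (isOpenMap_aug_modelχ p) hlift
    (ThetaSetting.modelχ_isEtThOrigin p)
    ((ThetaSetting.modelχ p).dtpYTheta_comm (ThetaSetting.modelχ_isEtThOrigin p)) (hYcl_modelχ p)

/-- **F-0649 at the record model tower, down to the FACT-policy floor MINUS the four interface / origin
binders**: abc-iut-L2-d1's `cor219_ii_model_of_facts` with `hslimX`, `haugOpen`, `IsEtThOrigin`, `hYcl`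
SUPPLIED — residual inputs: Prop. 1.5 (ii), (iii), cusp labels, Cor. 2.18 (i) at the chain levels and the
named fact `ThetaEnvTower.Cor219_iii` (constant multiple rigidity). [cite: MochizukiEtTh2009, Cor 2.19(ii) p.64] -/
theorem cor219_ii_modelχ_of_facts (hC : (ThetaSetting.modelχ p).Compat)
    (hS : (ThetaSetting.modelχ p).Sec2Hyps) (h15 : ThetaSetting.Prop15iii E hC)
    (h15ii : ThetaSetting.Prop15ii E.toKummerData hC) (L : C.CuspLabels)
    (h218i : ∀ M : Es, (C.rigidData (τ.mod M) hC hS h15 L).Cor218_i)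
    (h219iii : (C.thetaEnvTower τ hC hS).Cor219_iii) :
    Literature.AnabelianGeometry.EtaleTheta.ThetaEnvTower.Cor219_ii (C.thetaEnvTower τ hC hS) :=
  C.cor219_ii_model_of_facts τ hC hS h15 h15ii L (isSlimGroup_piTemp_modelχ p) (isOpenMap_aug_modelχ p)
    h218i h219iii (ThetaSetting.modelχ_isEtThOrigin p) (hYcl_modelχ p)

/-- **Cor. 2.19 (ii), STRONG form, at the record model tower** (every projective system of mono-theta
environments of `X̲̲` is isomorphic, compatibly with the reductions, to the natural system of ANY compatible
family of theta cocycles): abc-iut-L2-d1's `exists_iso_of_systems_model` with `hslimX`, `haugOpen` SUPPLIED —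
residual inputs: the level-wise `Cor218_iv_surjective`, `Cor218_iv_fibre`, `Cor218_ii`.
[cite: MochizukiEtTh2009, Cor 2.19(ii) p.64] -/
theorem exists_iso_of_systems_modelχ (hC : (ThetaSetting.modelχ p).Compat)
    (hS : (ThetaSetting.modelχ p).Sec2Hyps)
    (hlift : ∀ M : Es, ((C.thetaEnvTower τ hC hS).level M).Cor218_iv_surjective)
    (hfib : ∀ M : Es, ((C.thetaEnvTower τ hC hS).level M).Cor218_iv_fibre)
    (h218ii : ∀ M : Es, ((C.thetaEnvTower τ hC hS).level M).Cor218_ii)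
    (S : (C.thetaEnvTower τ hC hS).MTESystem)
    (η₀ : ∀ M : Es, (C.thetaEnvTower τ hC hS).PiYdd → (C.thetaEnvTower τ hC hS).mu M)
    (hη₀ : ∀ M, η₀ M ∈ (C.thetaEnvTower τ hC hS).thetaCocycles M)
    (hη₀c : ∀ (M M' : Es) (h : (M : ℕ+) ∣ M'), (C.thetaEnvTower τ hC hS).red M M' h ∘ η₀ M' = η₀ M) :
    ∃ α : ∀ M : Es, (((C.thetaEnvTower τ hC hS).level M).modelMono (hη₀ M)).Iso
        (((C.thetaEnvTower τ hC hS).level M).modelMono (S.mem M)),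
      ∀ (M M' : Es) (h : (M : ℕ+) ∣ M') (x : ((C.thetaEnvTower τ hC hS).level M').env),
        S.a M M' h ((C.thetaEnvTower τ hC hS).redEnv M M' h ((α M').e x)) =
          (α M).e ((C.thetaEnvTower τ hC hS).redEnv M M' h x) :=
  C.exists_iso_of_systems_model τ hC hS (isSlimGroup_piTemp_modelχ p) (isOpenMap_aug_modelχ p)
    hlift hfib h218ii S η₀ hη₀ hη₀c

/-- **Cor. 2.19 (ii), strong form, at the record model tower with Cor. 2.18 (ii) supplied by Prop. 1.5
(ii), (iii)** (gen 0's `exists_iso_of_systems_model_of_prop15`; `hslimX`, `haugOpen` SUPPLIED) — residual: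
Prop. 1.5 (ii), (iii) and the level-wise first half of Cor. 2.18 (iv). [cite: MochizukiEtTh2009, Cor 2.19(ii) p.64] -/
theorem exists_iso_of_systems_modelχ_of_prop15 (hC : (ThetaSetting.modelχ p).Compat)
    (hS : (ThetaSetting.modelχ p).Sec2Hyps) (h15 : ThetaSetting.Prop15iii E hC)
    (h15ii : ThetaSetting.Prop15ii E.toKummerData hC)
    (hlift : ∀ M : Es, ((C.thetaEnvTower τ hC hS).level M).Cor218_iv_surjective)
    (hfib : ∀ M : Es, ((C.thetaEnvTower τ hC hS).level M).Cor218_iv_fibre)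
    (S : (C.thetaEnvTower τ hC hS).MTESystem)
    (η₀ : ∀ M : Es, (C.thetaEnvTower τ hC hS).PiYdd → (C.thetaEnvTower τ hC hS).mu M)
    (hη₀ : ∀ M, η₀ M ∈ (C.thetaEnvTower τ hC hS).thetaCocycles M)
    (hη₀c : ∀ (M M' : Es) (h : (M : ℕ+) ∣ M'), (C.thetaEnvTower τ hC hS).red M M' h ∘ η₀ M' = η₀ M) :
    ∃ α : ∀ M : Es, (((C.thetaEnvTower τ hC hS).level M).modelMono (hη₀ M)).Iso
        (((C.thetaEnvTower τ hC hS).level M).modelMono (S.mem M)),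
      ∀ (M M' : Es) (h : (M : ℕ+) ∣ M') (x : ((C.thetaEnvTower τ hC hS).level M').env),
        S.a M M' h ((C.thetaEnvTower τ hC hS).redEnv M M' h ((α M').e x)) =
          (α M).e ((C.thetaEnvTower τ hC hS).redEnv M M' h x) :=
  C.exists_iso_of_systems_model_of_prop15 τ hC hS h15 h15ii (isSlimGroup_piTemp_modelχ p)
    (isOpenMap_aug_modelχ p) hlift hfib S η₀ hη₀ hη₀c

/-- **Cor. 2.19 (ii), strong form, at the record model tower, down to the FACT-policy floor MINUS the four
interface / origin binders** (gen 0's `exists_iso_of_systems_model_of_facts` with `hslimX`, `haugOpen`,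
`IsEtThOrigin`, `hYcl` SUPPLIED) — residual inputs: Prop. 1.5 (ii), (iii), cusp labels, Cor. 2.18 (i) at
the chain levels, `ThetaEnvTower.Cor219_iii`. [cite: MochizukiEtTh2009, Cor 2.19(ii) p.64] -/
theorem exists_iso_of_systems_modelχ_of_facts (hC : (ThetaSetting.modelχ p).Compat)
    (hS : (ThetaSetting.modelχ p).Sec2Hyps) (h15 : ThetaSetting.Prop15iii E hC)
    (h15ii : ThetaSetting.Prop15ii E.toKummerData hC) (L : C.CuspLabels)
    (h218i : ∀ M : Es, (C.rigidData (τ.mod M) hC hS h15 L).Cor218_i)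
    (h219iii : (C.thetaEnvTower τ hC hS).Cor219_iii) (S : (C.thetaEnvTower τ hC hS).MTESystem)
    (η₀ : ∀ M : Es, (C.thetaEnvTower τ hC hS).PiYdd → (C.thetaEnvTower τ hC hS).mu M)
    (hη₀ : ∀ M, η₀ M ∈ (C.thetaEnvTower τ hC hS).thetaCocycles M)
    (hη₀c : ∀ (M M' : Es) (h : (M : ℕ+) ∣ M'), (C.thetaEnvTower τ hC hS).red M M' h ∘ η₀ M' = η₀ M) :
    ∃ α : ∀ M : Es, (((C.thetaEnvTower τ hC hS).level M).modelMono (hη₀ M)).Iso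
        (((C.thetaEnvTower τ hC hS).level M).modelMono (S.mem M)),
      ∀ (M M' : Es) (h : (M : ℕ+) ∣ M') (x : ((C.thetaEnvTower τ hC hS).level M').env),
        S.a M M' h ((C.thetaEnvTower τ hC hS).redEnv M M' h ((α M').e x)) =
          (α M).e ((C.thetaEnvTower τ hC hS).redEnv M M' h x) :=
  C.exists_iso_of_systems_model_of_facts τ hC hS h15 h15ii L (isSlimGroup_piTemp_modelχ p)
    (isOpenMap_aug_modelχ p) h218i h219iii (ThetaSetting.modelχ_isEtThOrigin p) (hYcl_modelχ p) S η₀ hη₀ hη₀c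

/-- **Cor. 2.19 (i), subquotients, at the record model's rigidity data** (every automorphism of the model
mono-theta environment preserves `Π_{μ_N}`, `(l·Δ_Θ)[μ_N]`, `Δ^tp_Y[μ_N]`), modulo Cor. 2.18 (i) ALONE
(abc-iut-L2-d1's `cor219_i_subquotients_model`, `hslimX` SUPPLIED). [cite: MochizukiEtTh2009, Cor 2.19(i) p.64] -/
theorem cor219_i_subquotients_modelχ (hC : (ThetaSetting.modelχ p).Compat)
    (hS : (ThetaSetting.modelχ p).Sec2Hyps) (h15 : ThetaSetting.Prop15iii E hC) (L : C.CuspLabels)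
    (h218i : (C.rigidData μ hC hS h15 L).Cor218_i) :
    Literature.AnabelianGeometry.EtaleTheta.RigidData.Cor219_i_subquotients (C.rigidData μ hC hS h15 L) :=
  C.cor219_i_subquotients_model μ hC hS h15 L (isSlimGroup_piTemp_modelχ p) h218i

/-- **Cor. 2.19 (i), splittings (cyclotomic rigidity), at the record model's rigidity data**, modulo
Cor. 2.18 (i) ALONE: abc-iut-L2-d1's `cor219_i_splittings_model` with `hslimX` SUPPLIED and Prop. 2.14 (i)
DISCHARGED by abc-iut-f-149's `rigidData_prop214_i_modelχ`. [cite: MochizukiEtTh2009, Cor 2.19(i) p.64] -/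
theorem cor219_i_splittings_modelχ (hC : (ThetaSetting.modelχ p).Compat)
    (hS : (ThetaSetting.modelχ p).Sec2Hyps) (h15 : ThetaSetting.Prop15iii E hC) (L : C.CuspLabels)
    (h218i : (C.rigidData μ hC hS h15 L).Cor218_i) :
    Literature.AnabelianGeometry.EtaleTheta.RigidData.Cor219_i_splittings (C.rigidData μ hC hS h15 L) :=
  C.cor219_i_splittings_model μ hC hS h15 L (isSlimGroup_piTemp_modelχ p) h218i
    (rigidData_prop214_i_modelχ p C μ hC hS h15 L)

/-! ## §4. Lifting from level `1` at the record model tower -/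

/-- **Lifting from level `1` at the record model tower** ([EtTh] Cor. 2.18 (iv), p. 61): every automorphism
of the mod-`1` model lifts to the mod-`M` model, modulo Prop. 1.5 (iii) (input of `rigidData`) and the
Cor. 2.18 (iv) surjectivity fact at level `M` — abc-iut-L2-d1's `exists_iso_lift_of_levelOne_model` with
`hslimX`, `haugOpen` SUPPLIED. [cite: MochizukiEtTh2009, Cor 2.18(iv) p.61] -/
theorem exists_iso_lift_of_levelOne_modelχ (hC : (ThetaSetting.modelχ p).Compat)
    (hS : (ThetaSetting.modelχ p).Sec2Hyps) (h15 : ThetaSetting.Prop15iii E hC) (L : C.CuspLabels)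
    (M : Es) (hlift : (C.rigidData (τ.mod M) hC hS h15 L).Cor218_iv_surjective)
    {η : (C.thetaEnvTower τ hC hS).PiYdd → MuN p M}
    (hη : η ∈ (C.thetaEnvTower τ hC hS).thetaCocycles M)
    {η₁ : (C.thetaEnvTower τ hC hS).PiYdd → MuN p (⟨1, τ.one_mem⟩ : Es)}
    (hη₁ : η₁ ∈ (C.thetaEnvTower τ hC hS).thetaCocycles (⟨1, τ.one_mem⟩ : Es))
    (hcompat : (C.thetaEnvTower τ hC hS).red (⟨1, τ.one_mem⟩ : Es) M (one_dvd _) ∘ η = η₁)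
    (φ : (((C.thetaEnvTower τ hC hS).level (⟨1, τ.one_mem⟩ : Es)).modelMono hη₁).Iso
      (((C.thetaEnvTower τ hC hS).level (⟨1, τ.one_mem⟩ : Es)).modelMono hη₁)) :
    ∃ ψ : (((C.thetaEnvTower τ hC hS).level M).modelMono hη).Iso
        (((C.thetaEnvTower τ hC hS).level M).modelMono hη),
      ∀ x, (C.thetaEnvTower τ hC hS).redEnv (⟨1, τ.one_mem⟩ : Es) M (one_dvd _) (ψ.e x) =
        φ.e ((C.thetaEnvTower τ hC hS).redEnv (⟨1, τ.one_mem⟩ : Es) M (one_dvd _) x) :=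
  C.exists_iso_lift_of_levelOne_model τ hC hS (isSlimGroup_piTemp_modelχ p) (isOpenMap_aug_modelχ p)
    h15 L M hlift hη hη₁ hcompat φ

/-- **Finite fibres over level `1` at the record model tower** ([EtTh] Cor. 2.18 (iv), p. 63): only finitely
many automorphisms of the mod-`M` model reduce to the identity of the mod-`1` model, modulo Prop. 1.5 (iii)
ONLY — abc-iut-L2-d1's `finite_iso_over_levelOne_model_of_origin` with `IsEtThOrigin`, `hYcl` SUPPLIED.
[cite: MochizukiEtTh2009, Cor 2.18(iv) p.63] -/
theorem finite_iso_over_levelOne_modelχ (hC : (ThetaSetting.modelχ p).Compat)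
    (hS : (ThetaSetting.modelχ p).Sec2Hyps) (h15 : ThetaSetting.Prop15iii E hC) (L : C.CuspLabels)
    (M : Es) {η : (C.thetaEnvTower τ hC hS).PiYdd → MuN p M}
    (hη : η ∈ (C.thetaEnvTower τ hC hS).thetaCocycles M) :
    Set.Finite {ψ : (((C.thetaEnvTower τ hC hS).level M).modelMono hη).Iso
        (((C.thetaEnvTower τ hC hS).level M).modelMono hη) |
      ∀ x, (C.thetaEnvTower τ hC hS).redEnv (⟨1, τ.one_mem⟩ : Es) M (one_dvd _) (ψ.e x) =
        (C.thetaEnvTower τ hC hS).redEnv (⟨1, τ.one_mem⟩ : Es) M (one_dvd _) x} :=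
  C.finite_iso_over_levelOne_model_of_origin τ hC hS h15 L (ThetaSetting.modelχ_isEtThOrigin p)
    (hYcl_modelχ p) M hη

end Literature.AnabelianGeometry.EtaleTheta.SettingModel

end
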